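import Mathlib.Data.List.Shortlex
import Literature.Computability.Complexity.Classes
import Literature.Computability.Complexity.Nondeterministic
import Literature.Computability.Complexity.BoolEncodings
import Literature.Computability.Complexity.ProbabilisticClasses
import Literature.Computability.Complexity.ProbabilisticClassesProofs
import Literature.Computability.Complexity.PolyHierarchy
import Literature.Computability.Complexity.Oracle
import Literature.Computability.Cryptography.ClassBQP
import Literature.Computability.QuantumComplexity.Factoring
import HarnessLib

/-!
# Complexity classes of equivalence problems: `PEq`, `Ker(FP)`, `CF(FP)`, `LexEq(FP)`
# (Blass–Gurevich 1984; Fortnow–Grochow 2011)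

Named notions and named facts (D-0014) grounding route `PneNP/CanonicalForms`
(`Summit.PneNP.PneNP.Theses.CanonicalForms.*`), whose statements inline the notions below.

For an equivalence relation `E` on `{0,1}*` (Fortnow–Grochow 2011 = arXiv:0907.4775, §1 and
§2.2; Blass–Gurevich 1984, §1):

* the *recognition problem* is the language of pairs `⟨x, y⟩` with `x ~ y` (`relLang E`, paired
  by the tree's `boolPair`); `PEq` = equivalence relations whose recognition problem is in `P`;
* a *complete invariant* is `f` with `x ~ y ↔ f x = f y` (`IsCompleteInvariantFor`); `Ker(FP)`
  (`KerFP`) = relations that are the kernel of some `f ∈ FP`;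
* a *canonical form* is `f` with `x ~ f x` and `x ~ y → f x = f y` (`IsCanonicalFormFor`);
  `CF(FP)` (`CFFP`) = equivalence relations with a canonical form in `FP`;
* the *first canonical form* maps `x` to the FIRST member of `[x]` in the length-lexicographic
  order (`IsFirstCanonicalFormFor`, via Mathlib's `List.Shortlex (· < ·)` on `List Bool`,
  `false < true`); `LexEq(FP)` (`LexEqFP`).

"It is obvious that `LexEq ⊆ CF ⊆ Ker ⊆ PEq`" (FG §1); which inclusions are proper is OPEN
(FG §1 "our first guiding question"; BG 1984). The printed results vendored here as facts
(`def … : Prop`, to be taken as hypotheses `(h : factName)`):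

* `blassGurevich_PEq_subset_LexEq_FPNP` — `PEq ⊆ LexEq(FP^NP)` (binary search with an `NP`
  oracle; FG §3, first paragraph; BG 1984 §1);
* `blassGurevich_LexEq_of_P_eq_NP` — "all four polynomial-time classes of equivalence relations
  are equal in any world where `P = NP`" (FG §3, remark after Thm. 3.1), unrelativized instance:
  `P = NP → PEq ⊆ LexEq(FP)`; the route's support item `CanonOfPEqNP` is this fact followed by
  `LexEqFP ⊆ CFFP` (`canonicalForm_of_P_eq_NP` below);
* `fortnowGrochow_CF_eq_PEq` — "If `CF = PEq` then `NP = UP = RP` and thus `PH = BPP`"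
  (FG abstract (i) = Cor. 4.4);
* `fortnowGrochow_CF_eq_PEq_UP_subset_RP`, `fortnowGrochow_Ker_eq_PEq_UP_subset_BQP` — Thm. 4.3:
  "If `Ker = PEq` then `UP ⊆ BQP`. If `CF = PEq` then `UP ⊆ RP`";
* `fortnowGrochow_CF_eq_Ker_NP_eq_UP` — "If `CF = Ker` then `NP = UP`" (abstract (ii), Cor. 4.2
  of Thm. 4.1 `NPMV_g ⊆_c NPSV_g`);
* `blassGurevich_CF_eq_Ker_PH` — "If `CF = Ker` then `PH = ZPP^NP`" (FG Cor. 3.4, from BG part II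
  Thm. 3 + Hemaspaandra–Naik–Ogihara–Selman + Köbler–Watanabe); rendered as the inclusion
  `PH ⊆ RP^NP ∩ coRP^NP` with `RP^NP := rp (P^NP)` (the tree's operators `rp`, `co`, `PRelClass`);
* `fortnowGrochow_CF_eq_Ker_factoring`, `fortnowGrochow_rabinKernel_factoring` — "If `CF = Ker`
  then integers can be factored in probabilistic polynomial time" (abstract (ii), Prop. 4.10);
  the proof uses only an `FP` canonical form for the kernels of the Rabin function
  `x ↦ x² (mod N)`, which is the second, sharper fact. "Factored in probabilistic polynomial
  time" (a function-class statement; the printed algorithm is zero-error — a found gcd is always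
  a genuine factor, success probability `≥ 1/2` per round, primality in `P` — i.e. Las Vegas) is
  rendered by its decision consequence `QuantumComplexity.FACT ∈ ZPP` (implied by print; the
  `BPP` form is the proved corollary `fortnowGrochow_CF_eq_Ker_factoring.fact_mem_BPP`).

Theorem numbers are those of the arXiv version arXiv:0907.4775 (the journal version,
Inform. Comput. 209 (2011) 748–763, renumbers; the route text's "Prop 1.7 / Thm 4.1–4.3 /
OQ 5.10" refer to the journal numbering). Equalities of classes of relations "`CF = PEq`",
"`CF = Ker`", "`Ker = PEq`" are rendered as the non-trivial inclusions (`PEq ⊆ CFFP` etc.), the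
reverse inclusions being the "obvious" ones.

Small proved glue: a canonical form is a complete invariant, a first canonical form is a
canonical form (`LexEqFP ⊆ CFFP ⊆ KerFP`-direction lemmas), and `canonicalForm_of_P_eq_NP`
(fact ⟹ the route's `CanonOfPEqNP`, stated with the route's inlined notions).

## References

* A. Blass, Y. Gurevich, *Equivalence relations, invariants, and normal forms*, SIAM J. Comput.
  13 (1984) 682–689 [BlassGurevich1984]; part II in *Logic and Machines: Decision Problems and
  Complexity*, LNCS 171 (1984) 24–42.
* L. Fortnow, J. A. Grochow, *Complexity classes of equivalence problems revisited*, Inform.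
  Comput. 209 (2011) 748–763 = arXiv:0907.4775 [FortnowGrochow2011].
-/

namespace Literature.Computability.Complexity

open _root_.Computability

/-! ### Notions -/

/-- The recognition problem of a binary relation `E` on bit strings as a language of pairs
`⟨x, y⟩ = boolPair x y`. (Definitionally the set inlined by route PneNP/CanonicalForms.)
[Blass–Gurevich 1984, §1; Fortnow–Grochow 2011, §1] [cite: FortnowGrochow2011, §1 (recognition problem)] -/
def relLang (E : List Bool → List Bool → Prop) : Language Bool :=
  {w | ∃ x y, w = boolPair x y ∧ E x y}

/-- `f` is a complete invariant for `E`: `x ~ y ↔ f x = f y`, i.e. `E = Ker f`.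
[Fortnow–Grochow 2011, §2.2] [cite: FortnowGrochow2011, §2.2 (kernel, complete invariant)] -/
def IsCompleteInvariantFor (E : List Bool → List Bool → Prop) (f : List Bool → List Bool) : Prop :=
  ∀ x y, E x y ↔ f x = f y

/-- `c` is a canonical form for `E`: `c x ~ x` for all `x`, and `x ~ y → c x = c y`.
[Fortnow–Grochow 2011, §1 (canonical form problem) and §2.2] [cite: FortnowGrochow2011, §2.2 (canonical form)] -/
def IsCanonicalFormFor (E : List Bool → List Bool → Prop) (c : List Bool → List Bool) : Prop :=
  (∀ x, E (c x) x) ∧ ∀ x y, E x y → c x = c y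

/-- `c` is the first canonical form for `E`: `c x` is the first member of `[x]_E` in the standard
length-lexicographic order of `{0,1}*` (`List.Shortlex (· < ·)`, `false < true`): `c x ~ x` and no
`y ~ x` strictly precedes `c x`. [Fortnow–Grochow 2011, §1 (first canonical form problem) and §2.2] [cite: FortnowGrochow2011, §2.2 (first canonical form)] -/
def IsFirstCanonicalFormFor (E : List Bool → List Bool → Prop) (c : List Bool → List Bool) : Prop :=
  ∀ x, E (c x) x ∧ ∀ y, E y x → ¬ List.Shortlex (· < ·) y (c x)

/-- `PEq`: equivalence relations on `{0,1}*` whose recognition problem is in `P`.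
[Blass–Gurevich 1984, §1; Fortnow–Grochow 2011, Def. 1.1] [cite: FortnowGrochow2011, Def. 1.1] -/
def PEq : Set (List Bool → List Bool → Prop) :=
  {E | Equivalence E ∧ relLang E ∈ Classes.P}

/-- `Ker(FP)`: relations that are the kernel `{(x, y) | f x = f y}` of some `f ∈ FP` (such a
relation is automatically an equivalence relation in `PEq`). [Fortnow–Grochow 2011, Def. 1.1] [cite: FortnowGrochow2011, Def. 1.1] -/
def KerFP : Set (List Bool → List Bool → Prop) :=
  {E | ∃ f ∈ FP, IsCompleteInvariantFor E f}

/-- `CF(FP)`: equivalence relations with a polynomial-time canonical form.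
[Fortnow–Grochow 2011, Def. 1.1] [cite: FortnowGrochow2011, Def. 1.1] -/
def CFFP : Set (List Bool → List Bool → Prop) :=
  {E | Equivalence E ∧ ∃ c ∈ FP, IsCanonicalFormFor E c}

/-- `LexEq(FP)`: equivalence relations whose first canonical form is computable in polynomial
time. [Fortnow–Grochow 2011, Def. 1.1] [cite: FortnowGrochow2011, Def. 1.1] -/
def LexEqFP : Set (List Bool → List Bool → Prop) :=
  {E | Equivalence E ∧ ∃ c ∈ FP, IsFirstCanonicalFormFor E c}

/-- The Rabin function on pairs, `⟨N, x⟩ ↦ ⟨N, x² mod N⟩` (binary numerals `Computability.encodeNat`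
/ `decodeNat`, paired by `boolPair`); its kernel is Fortnow–Grochow's `R_N = {(x, y) | x² ≡ y² (mod N)}`
uniformly in `N`. [Fortnow–Grochow 2011, Prop. 4.10 (proof)] [cite: FortnowGrochow2011, Prop. 4.10 (proof)] -/
def rabinFn (w : List Bool) : List Bool :=
  boolPair (boolUnpair w).1
    (encodeNat ((decodeNat (boolUnpair w).2) ^ 2 % decodeNat (boolUnpair w).1))

/-! ### Named facts (D-0014): statements as printed, to be used as hypotheses -/

/-- **`PEq ⊆ LexEq(FP^NP)`** (Blass–Gurevich 1984; Fortnow–Grochow 2011, §3): "If `R ∈ PEq`, then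
the language `R' = {(x, y) : (∃ z)[z ≤_lex y and (x, z) ∈ R]}` is in `NP`, and can be used to
perform a binary search for the first canonical form for `R`. Hence `PEq ⊆ LexEq(FP^NP)`."
Rendered with `FP^NP = ⋃_{A ∈ NP} FPRel A`. [cite: FortnowGrochow2011, §3 (first paragraph)] -/
def blassGurevich_PEq_subset_LexEq_FPNP : Prop :=
  ∀ E ∈ PEq, ∃ A ∈ Nondeterministic.NP, ∃ c ∈ FPRel (Oracle.ofLanguage A),
    IsFirstCanonicalFormFor E c

/-- **`P = NP` collapses the four classes** (Fortnow–Grochow 2011, §3, after Thm. 3.1: "the above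
proof that `PEq ⊆ LexEq(FP^NP)` relativizes, so all four polynomial-time classes of equivalence
relations are equal in any world where `P = NP`"; Blass–Gurevich 1984), unrelativized instance:
if `P = NP` then every `PEq` relation has its first canonical form in `FP`. Grounds
`Summit.PneNP.PneNP.Theses.CanonicalForms.CanonOfPEqNP` (see `canonicalForm_of_P_eq_NP`).
[cite: FortnowGrochow2011, §3 (remark after Thm. 3.1)] -/
def blassGurevich_LexEq_of_P_eq_NP : Prop :=
  Classes.P = Nondeterministic.NP → PEq ⊆ LexEqFP

/-- **Fortnow–Grochow 2011, abstract (i) / Cor. 4.4**: "If `CF = PEq` then `NP = UP = RP` and thus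
`PH = BPP`." (`CF = PEq` rendered as `PEq ⊆ CF(FP)`.) Recorded consequence of the route's kill
switch `Summit.PneNP.PneNP.Theses.CanonicalForms.PEqHasCF`. [cite: FortnowGrochow2011, Cor. 4.4] -/
def fortnowGrochow_CF_eq_PEq : Prop :=
  PEq ⊆ CFFP → Nondeterministic.NP = UP ∧ Nondeterministic.NP = RP ∧ PH = BPP

/-- **Fortnow–Grochow 2011, Thm. 4.3 (second half)**: "If `CF = PEq` then `UP ⊆ RP`."
[cite: FortnowGrochow2011, Thm. 4.3] -/
def fortnowGrochow_CF_eq_PEq_UP_subset_RP : Prop :=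
  PEq ⊆ CFFP → UP ⊆ RP

/-- **Fortnow–Grochow 2011, Thm. 4.3 (first half) / abstract (iii)**: "If `Ker = PEq` then
`UP ⊆ BQP`" (every `UP` language reduces to Simon's problem). `Ker = PEq` rendered as: every `PEq`
relation has a complete invariant in `FP`. [cite: FortnowGrochow2011, Thm. 4.3] -/
def fortnowGrochow_Ker_eq_PEq_UP_subset_BQP : Prop :=
  (∀ E ∈ PEq, ∃ f ∈ FP, IsCompleteInvariantFor E f) → UP ⊆ Cryptography.BQP

/-- **Fortnow–Grochow 2011, abstract (ii) / Cor. 4.2** (of Thm. 4.1, `CF = Ker ⟹ NPMV_g ⊆_c NPSV_g`):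
"If `CF = Ker` then `NP = UP`." (`CF = Ker` rendered as `Ker(FP) ⊆ CF(FP)`.)
[cite: FortnowGrochow2011, Cor. 4.2] -/
def fortnowGrochow_CF_eq_Ker_NP_eq_UP : Prop :=
  KerFP ⊆ CFFP → Nondeterministic.NP = UP

/-- **Fortnow–Grochow 2011, Cor. 3.4** (Blass–Gurevich part II Thm. 3 + Hemaspaandra–Naik–Ogihara–
Selman 1994 + Köbler–Watanabe): "If `CF = Ker` then `PH = ZPP^NP`." Rendered as the inclusion
`PH ⊆ RP^NP ∩ coRP^NP` with `RP^NP = rp (P^NP)` in the tree's operator calculus (`ZPP = RP ∩ coRP`,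
`ProbabilisticClasses.lean`); the reverse inclusion is unconditional. [cite: FortnowGrochow2011, Cor. 3.4] -/
def blassGurevich_CF_eq_Ker_PH : Prop :=
  KerFP ⊆ CFFP →
    PH ⊆ rp (PRelClass Nondeterministic.NP) ∩ co (rp (PRelClass Nondeterministic.NP))

/-- **Fortnow–Grochow 2011, abstract (ii) / Prop. 4.10**: "If `CF = Ker` then … integers can be
factored in probabilistic polynomial time" (the printed algorithm is Las Vegas: zero error,
expected polynomial time). Decision rendering (implied by the printed function statement): the
factoring language `FACT = {⟨N, k⟩ | ∃ d, 1 < d ≤ k, d ∣ N}` is in `ZPP` (`= RP ∩ coRP`).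
[cite: FortnowGrochow2011, Prop. 4.10] -/
def fortnowGrochow_CF_eq_Ker_factoring : Prop :=
  KerFP ⊆ CFFP → QuantumComplexity.FACT ∈ ZPP

/-- **Fortnow–Grochow 2011, proof of Prop. 4.10** (the Rabin kernel): the proof uses only that
"the kernel of the Rabin function `x ↦ x² (mod N)`, `R_N = {(x, y) : x² ≡ y² (mod N)}`, has a
canonical form `f ∈ FP`" — pick `x` at random, `y = f(x)`; if `y ≢ ±x` then `gcd(N, x − y)` is a
proper factor, which happens with probability `≥ 1/2` for odd composite `N` (zero error: Las
Vegas). So: an `FP` canonical form for the kernel of `rabinFn` (uniform in `N`) puts `FACT` in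
`ZPP`. This is the printed source of the sandwich "Factoring ∉ ZPP ⟹ `Ker(FP) ⊄ CF(FP)`" used by
route PneNP/CanonicalForms (`Summit.PneNP.PneNP.Theses.CanonicalForms.KerNotCF`).
[cite: FortnowGrochow2011, Prop. 4.10 (proof)] -/
def fortnowGrochow_rabinKernel_factoring : Prop :=
  (∃ c ∈ FP, IsCanonicalFormFor (fun u v => rabinFn u = rabinFn v) c) →
    QuantumComplexity.FACT ∈ ZPP

/-! ### Proved glue -/

/-- The `BPP` form of `fortnowGrochow_CF_eq_Ker_factoring` (`ZPP ⊆ RP ⊆ BPP`, the latter by the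
tree's `RP_subset_BPP_holds`). [cite: FortnowGrochow2011, Prop. 4.10] -/
theorem fortnowGrochow_CF_eq_Ker_factoring.fact_mem_BPP (h : fortnowGrochow_CF_eq_Ker_factoring)
    (hK : KerFP ⊆ CFFP) : QuantumComplexity.FACT ∈ BPP :=
  RP_subset_BPP_holds (h hK).1

/-- The `BPP` form of `fortnowGrochow_rabinKernel_factoring`. [cite: FortnowGrochow2011, Prop. 4.10 (proof)] -/
theorem fortnowGrochow_rabinKernel_factoring.fact_mem_BPP (h : fortnowGrochow_rabinKernel_factoring)
    (hc : ∃ c ∈ FP, IsCanonicalFormFor (fun u v => rabinFn u = rabinFn v) c) :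
    QuantumComplexity.FACT ∈ BPP :=
  RP_subset_BPP_holds (h hc).1

/-- A canonical form of an equivalence relation is a complete invariant ("It is obvious that
`CF ⊆ Ker`"). [Fortnow–Grochow 2011, §1] [cite: FortnowGrochow2011, §1 (CF ⊆ Ker ⊆ PEq)] -/
theorem IsCanonicalFormFor.isCompleteInvariantFor {E : List Bool → List Bool → Prop}
    {c : List Bool → List Bool} (hE : Equivalence E) (hc : IsCanonicalFormFor E c) :
    IsCompleteInvariantFor E c := by
  intro x y
  refine ⟨hc.2 x y, fun h => ?_⟩
  have hx : E x (c x) := hE.symm (hc.1 x)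
  have hy : E (c y) y := hc.1 y
  rw [h] at hx
  exact hE.trans hx hy

/-- The first canonical form is a canonical form ("`LexEq ⊆ CF`"): two shortlex-minimal members
of one class coincide (trichotomy of the shortlex order on `List Bool`).
[Fortnow–Grochow 2011, §1] [cite: FortnowGrochow2011, §1 (LexEq ⊆ CF)] -/
theorem IsFirstCanonicalFormFor.isCanonicalFormFor {E : List Bool → List Bool → Prop}
    {c : List Bool → List Bool} (hE : Equivalence E) (hc : IsFirstCanonicalFormFor E c) :
    IsCanonicalFormFor E c := by
  refine ⟨fun x => (hc x).1, fun x y hxy => ?_⟩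
  -- `c x` and `c y` are both shortlex-least in the common class of `x` and `y`
  have hcx : E (c x) y := hE.trans (hc x).1 hxy
  have hcy : E (c y) x := hE.trans (hc y).1 (hE.symm hxy)
  have h1 : ¬ List.Shortlex (· < ·) (c y) (c x) := (hc x).2 (c y) hcy
  have h2 : ¬ List.Shortlex (· < ·) (c x) (c y) := (hc y).2 (c x) hcx
  exact Std.Trichotomous.trichotomous (r := List.Shortlex (· < ·)) (c x) (c y) h2 h1

/-- `LexEq(FP) ⊆ CF(FP)`. [Fortnow–Grochow 2011, §1] [cite: FortnowGrochow2011, §1 (LexEq ⊆ CF)] -/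
theorem LexEqFP_subset_CFFP : LexEqFP ⊆ CFFP := by
  rintro E ⟨hE, c, hc, hfc⟩
  exact ⟨hE, c, hc, hfc.isCanonicalFormFor hE⟩

/-- `CF(FP) ⊆ Ker(FP)`. [Fortnow–Grochow 2011, §1] [cite: FortnowGrochow2011, §1 (CF ⊆ Ker)] -/
theorem CFFP_subset_KerFP : CFFP ⊆ KerFP := by
  rintro E ⟨hE, c, hc, hcf⟩
  exact ⟨c, hc, hcf.isCompleteInvariantFor hE⟩

/-- **The route's assembly lemma from the fact**: under `blassGurevich_LexEq_of_P_eq_NP`,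
`P = NP` gives every `P`-decidable equivalence relation an `FP` canonical form — literally
`Summit.PneNP.PneNP.Theses.CanonicalForms.CanonOfPEqNP` (notions inlined as in the route file).
[cite: FortnowGrochow2011, §3 (remark after Thm. 3.1)] -/
theorem canonicalForm_of_P_eq_NP (h : blassGurevich_LexEq_of_P_eq_NP)
    (hPNP : Classes.P = Nondeterministic.NP) (E : List Bool → List Bool → Prop) (hE : Equivalence E)
    (hP : ({w | ∃ x y, w = boolPair x y ∧ E x y} : Language Bool) ∈ Classes.P) :
    ∃ c ∈ FP, (∀ x, E (c x) x) ∧ ∀ x y, E x y → c x = c y := by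
  obtain ⟨-, c, hc, hfc⟩ := LexEqFP_subset_CFFP (h hPNP ⟨hE, hP⟩)
  exact ⟨c, hc, hfc⟩

end Literature.Computability.Complexity
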